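import Literature.Probability.LatticeModels.MessagerMiracleSole
import Literature.Probability.LatticeModels.SharpnessProofs
import HarnessLib

/-!
# The Messager–Miracle-Solé inequality for the free state, and eq. (4.10) of Duminil-Copin 2019

Theorem-only sibling of `MessagerMiracleSole` (which treats the plus state): the same folding
argument for the **free** boundary condition (the case actually printed in Hegerfeldt 1977,
Thms. 3.1–3.2: free or periodic boundary conditions on reflection-symmetric volumes), the free
state of `ℤ^d` along the symmetrised boxes (free correlations are *nondecreasing* in the volume,
Friedli–Velenik 2017, Exercise 3.12), the two monotonicity statements for `⟨σ₀σ_x⟩^f_β`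
(`messager_miracleSole_free`, `messager_miracleSole_diag_free`), and, by the combinatorial walk
of Duminil-Copin 2019, §4.3, Exercise 37 (4), the **discharge of the named facts
`twoPointFree_le_axis_of_mem_sphere` and `twoPointFree_diagAxis_le_of_mem_sphere`**
(`SharpnessProofs`, Part I: the two halves of eq. (4.10) for the free state).

The finite-volume input is that the glued configuration of the free boundary condition
coincides with that of the `+` condition (both are `+1` off the volume; only the interacting
edge set differs: `ℰ_Λ` instead of `ℰ_Λ^b`), so the even/odd variables `siteS`, `siteT`,
`symEdgeTerm` of `MessagerMiracleSole` are reused verbatim.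

References: as in `MessagerMiracleSole` (Messager–Miracle-Solé 1977; Hegerfeldt 1977, Lemma 2.1,
Main Lemma (2.8), Thm. 3.1 (3.8), Thm. 3.2 (3.10)); Duminil-Copin 2019, §4.3, Exercise 37 and
eq. (4.10); Friedli–Velenik 2017, Exercise 3.12 (free), Exercise 3.14 (symmetries).
-/

noncomputable section

open Finset

namespace Literature.Probability.LatticeModels

/-! ### Folding the free-boundary Ising model -/

section IsingFoldFree

variable {V : Type*} [DecidableEq V] (G : SimpleGraph V) [G.LocallyFinite]
variable (θ : V ≃ V) (P : V → Prop) [DecidablePred P] (Λ : Finset V)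

omit [DecidableEq V] in
/-- The glued configurations of the free and the `+` boundary conditions coincide (both are `+1`
off `Λ`). [folklore] -/
theorem glue_free_eq_glue_plus_cfg (ω : SpinConfig ↥Λ) : glue Λ ω .free = glue Λ ω .plus := by
  funext x
  by_cases hx : x ∈ Λ
  · rw [glue_apply_of_mem _ _ _ hx, glue_apply_of_mem _ _ _ hx]
  · rw [glue_apply_of_notMem _ _ _ hx, glue_apply_of_notMem _ _ _ hx]
    rfl

variable {θ Λ}

/-- **The free-boundary Hamiltonian of a `θ`-symmetric volume in the even/odd variables**:
`-βH^∅ = ∑_{e ∈ ℰ_Λ} β (σ_e + σ_{θe})/2 + ∑_z βh (σ_z + σ_{θz})/2` (Messager–Miracle-Solé 1977;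
Hegerfeldt 1977, §3, free boundary conditions). [cite: Hegerfeldt1977, §2, Main Lemma, eq. (2.8)] -/
theorem neg_mul_isingHamiltonian_free_eq (hadj : ∀ x y, G.Adj (θ x) (θ y) ↔ G.Adj x y)
    (hΛ : ∀ x, x ∈ Λ ↔ θ x ∈ Λ) (β h : ℝ) (ω : SpinConfig ↥Λ) :
    -β * isingHamiltonian G Λ h .free (glue Λ ω .free) =
      ∑ e ∈ edgesIn G Λ, β * symEdgeTerm θ Λ e ω + ∑ z ∈ Λ, β * h * siteS θ Λ z ω := by
  rw [glue_free_eq_glue_plus_cfg]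
  set σ := glue Λ ω .plus with hσ
  have hsym := isingHamiltonian_comp G θ hadj hΛ h .free σ
  have hH : ∀ τ : SpinConfig V, isingHamiltonian G Λ h .free τ =
      -(∑ e ∈ edgesIn G Λ, bondSpin τ e) - h * ∑ z ∈ Λ, spinAt z τ := fun τ => by
    rw [isingHamiltonian, interactionEdges_free]
  have h2 : isingHamiltonian G Λ h .free (σ ∘ θ) =
      -(∑ e ∈ edgesIn G Λ, bondSpin σ (Sym2.map θ e)) - h * ∑ z ∈ Λ, spinAt (θ z) σ := by
    rw [hH]
    simp_rw [bondSpin_comp]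
    rfl
  have eE : ∑ e ∈ edgesIn G Λ, β * symEdgeTerm θ Λ e ω =
      β / 2 * ((∑ e ∈ edgesIn G Λ, bondSpin σ e) +
        ∑ e ∈ edgesIn G Λ, bondSpin σ (Sym2.map θ e)) := by
    rw [← Finset.sum_add_distrib, Finset.mul_sum]
    refine Finset.sum_congr rfl fun e _ => ?_
    rw [symEdgeTerm]
    ring
  have eS : ∑ z ∈ Λ, β * h * siteS θ Λ z ω =
      β * h / 2 * ((∑ z ∈ Λ, spinAt z σ) + ∑ z ∈ Λ, spinAt (θ z) σ) := by
    rw [← Finset.sum_add_distrib, Finset.mul_sum]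
    refine Finset.sum_congr rfl fun z _ => ?_
    rw [siteS]
    ring
  have e0 : -β * isingHamiltonian G Λ h .free σ =
      -(β / 2) * (isingHamiltonian G Λ h .free σ + isingHamiltonian G Λ h .free (σ ∘ θ)) := by
    rw [hsym]; ring
  rw [eE, eS, e0, hH σ, h2]
  ring

/-- The free-boundary Boltzmann weight of a `θ`-symmetric volume as `exp` of the folded Hamiltonian. [cite: Hegerfeldt1977, §2, Main Lemma, eq. (2.8)] -/
theorem isingWeight_free_eq_exp_fold (hadj : ∀ x y, G.Adj (θ x) (θ y) ↔ G.Adj x y)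
    (hΛ : ∀ x, x ∈ Λ ↔ θ x ∈ Λ) (β h : ℝ) (ω : SpinConfig ↥Λ) :
    isingWeight G Λ β h .free ω =
      Real.exp (∑ e ∈ edgesIn G Λ, β * symEdgeTerm θ Λ e ω) *
        (Real.exp (∑ z ∈ Λ, β * h * siteS θ Λ z ω) * (fun _ => (1 : ℝ)) ω) := by
  rw [isingWeight, neg_mul_isingHamiltonian_free_eq G hadj hΛ, Real.exp_add]
  ring

/-- **First Griffiths inequality for the folded free state**: `∑_ω M(ω) e^{-βH^∅(ω)} ≥ 0` for every
folded monomial `M` (Hegerfeldt 1977, §2, Main Lemma, free boundary conditions). [cite: Hegerfeldt1977, §2, Main Lemma, eq. (2.8)] -/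
theorem sum_foldedClass_mul_isingWeight_free_nonneg (hθ : Function.Involutive θ)
    (hadj : ∀ x y, G.Adj (θ x) (θ y) ↔ G.Adj x y) (hPθ : ∀ x, P x → ¬P (θ x))
    (hfix : ∀ x, ¬P x → ¬P (θ x) → θ x = x)
    (hedge : ∀ x y, G.Adj x y → P x → ¬P y → θ y ≠ y → y = θ x)
    (hΛ : ∀ x, x ∈ Λ ↔ θ x ∈ Λ) {β h : ℝ} (hβ : 0 ≤ β) (hh : 0 ≤ h) :
    ∀ M ∈ foldedClass (volInvol θ Λ hΛ) (volSide P Λ),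
      0 ≤ ∑ ω, M ω * isingWeight G Λ β h .free ω := by
  intro M hM
  have hθv : Function.Involutive (volInvol θ Λ hΛ) := fun z => Subtype.ext (hθ z)
  have hPv : ∀ u ∈ volSide P Λ, volInvol θ Λ hΛ u ∉ volSide P Λ := fun u hu => by
    rw [mem_volSide] at hu ⊢
    exact hPθ u hu
  simp_rw [isingWeight_free_eq_exp_fold G hadj hΛ β h]
  refine sum_foldedClass_mul_exp_nonneg _ _ (edgesIn G Λ)
    (fun e ω => β * symEdgeTerm θ Λ e ω) ?_ ?_ M hM
  · intro e he
    have he' : e ∈ G.edgeSet := (mem_edgesIn_iff.1 he).1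
    revert he'
    induction e using Sym2.ind with
    | _ x y =>
      intro he'
      have hfun : (fun ω => β * symEdgeTerm θ Λ s(x, y) ω) = fun ω => β * edgeTerm θ Λ x y ω := by
        funext ω; rw [symEdgeTerm_mk]
      rw [hfun]
      exact isFoldedTerm_edgeTerm G hθ hfix hedge hΛ hβ ((SimpleGraph.mem_edgeSet G).1 he')
  · exact sum_foldedClass_mul_exp_nonneg _ _ Λ (fun z ω => β * h * siteS θ Λ z ω)
      (fun z _ => ⟨β * h, 0, 0, siteS θ Λ z, fun _ => 1, mul_nonneg hβ hh, le_rfl,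
        siteS_mem_foldedClass hθ hfix hΛ z, one_mem_foldedClass _ _, fun ω => by ring⟩)
      (sum_foldedClass_mul_one_nonneg hθv hPv)

/-- **The Messager–Miracle-Solé inequality in finite volume, free boundary condition** (pair
form): for an involutive automorphism `θ` of the graph, a `θ`-stable volume `Λ`, a positive side `P`
with `θ(P) ∩ P = ∅`, all sites off `P ∪ θ(P)` fixed, and no bond from `P` to `θ(P)` other than the
bonds `{x, θx}`: `⟨σ_a σ_{θb}⟩^∅_{Λ;β,h} ≤ ⟨σ_a σ_b⟩^∅_{Λ;β,h}` for `a ≠ b` on the positive side,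
`β, h ≥ 0` (Hegerfeldt 1977, §3, eq. (3.7) with free boundary conditions; Messager–Miracle-Solé
1977). [cite: Hegerfeldt1977, §2, Main Lemma, eq. (2.8)] [cite: MessagerMiracleSoleJSP1977, main theorem (monotonicity of ⟨σ₀σ_x⟩ under reflections)] -/
theorem isingCorr_free_pair_reflect_le (hθ : Function.Involutive θ)
    (hadj : ∀ x y, G.Adj (θ x) (θ y) ↔ G.Adj x y) (hPθ : ∀ x, P x → ¬P (θ x))
    (hfix : ∀ x, ¬P x → ¬P (θ x) → θ x = x)
    (hedge : ∀ x y, G.Adj x y → P x → ¬P y → θ y ≠ y → y = θ x)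
    (hΛ : ∀ x, x ∈ Λ ↔ θ x ∈ Λ) {β h : ℝ} (hβ : 0 ≤ β) (hh : 0 ≤ h)
    {a b : V} (ha : a ∈ Λ) (hb : b ∈ Λ) (hPa : P a) (hPb : P b) (hab : a ≠ b) :
    isingCorr G Λ β h .free {a, θ b} ≤ isingCorr G Λ β h .free {a, b} := by
  have haθb : a ≠ θ b := fun h' => hPθ b hPb (h' ▸ hPa)
  rw [isingCorr, isingCorr, isingExpect, isingExpect,
    integral_isingMeasure G Λ β h _ (measurable_spinProduct _),
    integral_isingMeasure G Λ β h _ (measurable_spinProduct _)]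
  refine div_le_div_of_nonneg_right ?_ (isingPartitionFunction_pos G Λ β h _).le
  rw [← sub_nonneg, ← Finset.sum_sub_distrib]
  set θv := volInvol θ Λ hΛ with hθv
  set ua : ↥Λ := ⟨a, ha⟩ with hua
  set ub : ↥Λ := ⟨b, hb⟩ with hub
  have key : ∀ ω : SpinConfig ↥Λ,
      isingWeight G Λ β h .free ω * spinProduct {a, b} (glue Λ ω .free) -
        isingWeight G Λ β h .free ω * spinProduct {a, θ b} (glue Λ ω .free) =
      2 * (sVar θv ua ω * tVar θv ub ω * isingWeight G Λ β h .free ω) +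
        2 * (tVar θv ua ω * tVar θv ub ω * isingWeight G Λ β h .free ω) := by
    intro ω
    rw [glue_free_eq_glue_plus_cfg, spinProduct, spinProduct, Finset.prod_pair hab, Finset.prod_pair haθb,
      spinAt_glue_of_mem ω _ ha, spinAt_glue_of_mem ω _ hb, spinAt_glue_of_mem ω _ ((hΛ b).1 hb),
      spinAt_eq_sVar_add_tVar θv ua, spinAt_eq_sVar_add_tVar θv ub,
      show spinAt (⟨θ b, (hΛ b).1 hb⟩ : ↥Λ) ω = spinAt (θv ub) ω from rfl,
      spinAt_apply_eq_sVar_sub_tVar θv ub]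
    ring
  simp_rw [key]
  rw [Finset.sum_add_distrib, ← Finset.mul_sum, ← Finset.mul_sum]
  have hW := sum_foldedClass_mul_isingWeight_free_nonneg G (P := P) hθ hadj hPθ hfix hedge hΛ hβ hh
  have hPa' : ua ∈ volSide P Λ := (mem_volSide P Λ).2 hPa
  have hPb' : ub ∈ volSide P Λ := (mem_volSide P Λ).2 hPb
  exact add_nonneg
    (mul_nonneg two_pos.le (hW _ (mul_mem_foldedClass _ _
      (sVar_mem_foldedClass _ _ hPa') (tVar_mem_foldedClass _ _ hPb'))))
    (mul_nonneg two_pos.le (hW _ (mul_mem_foldedClass _ _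
      (tVar_mem_foldedClass _ _ hPa') (tVar_mem_foldedClass _ _ hPb'))))

end IsingFoldFree

/-! ### The free state of `ℤ^d` along symmetrised boxes and the reflection inequality -/

section ZdReflectFree

open Filter Topology

variable {d : ℕ}

/-- **The free state along symmetrised boxes**: `⟨σ_A⟩^∅_{Λ(L) ∪ θΛ(L);β,h} → ⟨σ_A⟩^∅_{β,h}`, by the
sandwich `⟨σ_A⟩^∅_{Λ(L)} ≤ ⟨σ_A⟩^∅_{Λ(L) ∪ θΛ(L)} ≤ ⟨σ_A⟩^∅_{Λ(L+R)}` (monotonicity of the free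
correlations in the volume, Friedli–Velenik 2017, Exercise 3.12, and existence of the free state
along boxes, Exercise 3.16). [cite: FriedliVelenik2017, Exercise 3.12, p. 112] -/
theorem tendsto_isingCorr_free_symBox {θ : Site d ≃ Site d} {R : ℕ}
    (hR : ∀ L, ∀ y ∈ box d L, θ y ∈ box d (L + R)) {β h : ℝ} (hβ : 0 ≤ β) (hh : 0 ≤ h)
    (A : Finset (Site d)) :
    Tendsto (fun L => isingCorr (zdGraph d) (symBox θ L) β h .free A) atTop
      (𝓝 (freeCorr d β h A)) := by
  obtain ⟨L₀, hL₀⟩ := exists_forall_subset_box d A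
  have hg : Tendsto (fun L => isingCorr (zdGraph d) (box d L) β h .free A) atTop
      (𝓝 (freeCorr d β h A)) := hasBoxLimit_isingCorr_free_holds hβ hh A
  have hf : Tendsto (fun L => isingCorr (zdGraph d) (box d (L + R)) β h .free A) atTop
      (𝓝 (freeCorr d β h A)) := (Filter.tendsto_add_atTop_iff_nat R).2 hg
  refine tendsto_of_tendsto_of_tendsto_of_le_of_le' hg hf ?_ ?_
  · filter_upwards [eventually_ge_atTop L₀] with L hL
    exact isingCorr_free_le_of_subset (zdGraph d) hβ hh (hL₀ L hL) (box_subset_symBox θ L)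
  · filter_upwards [eventually_ge_atTop L₀] with L hL
    exact isingCorr_free_le_of_subset (zdGraph d) hβ hh
      ((hL₀ L hL).trans (box_subset_symBox θ L)) (symBox_subset_box hR L)

/-- **The Messager–Miracle-Solé inequality for the free state** (pair form; hypotheses as in
`plusCorr_pair_reflect_le`): `⟨σ_a σ_{θb}⟩^∅_{β,h} ≤ ⟨σ_a σ_b⟩^∅_{β,h}` for `a ≠ b ∈ P`, `β, h ≥ 0`
(Hegerfeldt 1977, Thms. 3.1–3.2 are stated for the free or periodic boundary condition). [cite: Hegerfeldt1977, §2, Main Lemma, eq. (2.8)] [cite: MessagerMiracleSoleJSP1977, main theorem (monotonicity of ⟨σ₀σ_x⟩ under reflections)] -/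
theorem freeCorr_pair_reflect_le (θ : Site d ≃ Site d) (hθ : Function.Involutive θ)
    (hadj : ∀ x y, (zdGraph d).Adj (θ x) (θ y) ↔ (zdGraph d).Adj x y)
    (P : Site d → Prop) [DecidablePred P] (hPθ : ∀ x, P x → ¬P (θ x))
    (hfix : ∀ x, ¬P x → ¬P (θ x) → θ x = x)
    (hedge : ∀ x y, (zdGraph d).Adj x y → P x → ¬P y → θ y ≠ y → y = θ x)
    {R : ℕ} (hR : ∀ L, ∀ y ∈ box d L, θ y ∈ box d (L + R)) {β h : ℝ} (hβ : 0 ≤ β) (hh : 0 ≤ h)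
    {a b : Site d} (hPa : P a) (hPb : P b) (hab : a ≠ b) :
    freeCorr d β h {a, θ b} ≤ freeCorr d β h {a, b} := by
  refine le_of_tendsto_of_tendsto (tendsto_isingCorr_free_symBox hR hβ hh {a, θ b})
    (tendsto_isingCorr_free_symBox hR hβ hh {a, b}) ?_
  obtain ⟨L₀, hL₀⟩ := exists_forall_subset_box d {a, b}
  filter_upwards [eventually_ge_atTop L₀] with L hL
  have hsub : ({a, b} : Finset (Site d)) ⊆ symBox θ L := (hL₀ L hL).trans (box_subset_symBox θ L)
  have ha : a ∈ symBox θ L := hsub (Finset.mem_insert_self a {b})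
  have hb : b ∈ symBox θ L := hsub (Finset.mem_insert_of_mem (Finset.mem_singleton_self b))
  exact isingCorr_free_pair_reflect_le (zdGraph d) (P := P) hθ hadj hPθ hfix hedge
    (fun x => mem_symBox_iff hθ x) hβ hh ha hb hPa hPb hab

/-- **Messager–Miracle-Solé for the half-integer axis hyperplanes, free state**: for `k` odd and `β, h ≥ 0`,
`⟨σ_a σ_{θb}⟩^∅ ≤ ⟨σ_a σ_b⟩^∅` for the reflection `θ` through `{yᵢ = k/2}` and `a ≠ b` with
`2aᵢ < k`, `2bᵢ < k` (Messager–Miracle-Solé 1977; Hegerfeldt 1977, Thm. 3.1, eq. (3.8):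
"`⟨σ₀σ_{(i₁,i)}⟩` is monotone decreasing in `i₁` on `{i₁ ≥ 0}`", reflections `Θ_{αe}` with
`2α ∈ ℤ^d`; cf. Friedli–Velenik 2017, §3.10.6). [cite: MessagerMiracleSoleJSP1977, main theorem (monotonicity of ⟨σ₀σ_x⟩ under reflections)] [cite: Hegerfeldt1977, Thm. 3.1, eq. (3.8)] -/
theorem freeCorr_pair_axisRefl_le (i : Fin d) {k : ℤ} (hk : Odd k) {β h : ℝ} (hβ : 0 ≤ β)
    (hh : 0 ≤ h) {a b : Site d} (ha : 2 * a i < k) (hb : 2 * b i < k) (hab : a ≠ b) :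
    freeCorr d β h {a, axisRefl i k b} ≤ freeCorr d β h {a, b} := by
  classical
  refine freeCorr_pair_reflect_le (axisRefl i k) (axisRefl_involutive i k)
    (zdGraph_adj_axisRefl i k) (fun y : Site d => 2 * y i < k) ?_ ?_ ?_
    (R := k.natAbs) (axisRefl_mem_box i k) hβ hh ha hb hab
  · intro y hy
    simp only [axisRefl_apply, if_true, not_lt]
    omega
  · intro y hy hθy
    simp only [axisRefl_apply, if_true, not_lt] at hy hθy
    exfalso
    obtain ⟨m, rfl⟩ := hk
    omega
  · intro y z hyz hy hz _
    simp only [not_lt] at hz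
    obtain ⟨l, hl, hrest⟩ := zdGraph_adj_coord hyz
    funext m
    rw [axisRefl_apply]
    by_cases hm : m = i
    · subst hm
      rw [if_pos rfl]
      by_cases hlm : l = m
      · subst hlm
        obtain ⟨n, rfl⟩ := hk
        omega
      · have := hrest m (Ne.symm hlm)
        omega
    · rw [if_neg hm]
      by_cases hlm : l = m
      · subst hlm
        have := hrest i (Ne.symm hm) -- z i = y i
        omega
      · exact hrest m (Ne.symm hlm)

/-- **Messager–Miracle-Solé for the diagonal hyperplanes, free state**: for `i ≠ j`, `c ∈ ℤ`, `β, h ≥ 0`,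
`⟨σ_a σ_{θb}⟩^∅ ≤ ⟨σ_a σ_b⟩^∅` for the reflection `θ` through `{yᵢ - yⱼ = c}` and `a ≠ b` with
`aᵢ - aⱼ < c`, `bᵢ - bⱼ < c` (Messager–Miracle-Solé 1977; Hegerfeldt 1977, Thm. 3.2, eq. (3.10),
reflections at the "diagonal hyperplanes" `{i·e = a}`, `e = eᵢ - eⱼ`). [cite: MessagerMiracleSoleJSP1977, main theorem (monotonicity of ⟨σ₀σ_x⟩ under reflections)] [cite: Hegerfeldt1977, Thm. 3.2, eq. (3.10)] -/
theorem freeCorr_pair_diagRefl_le {i j : Fin d} (hij : i ≠ j) (c : ℤ) {β h : ℝ} (hβ : 0 ≤ β)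
    (hh : 0 ≤ h) {a b : Site d} (ha : a i - a j < c) (hb : b i - b j < c) (hab : a ≠ b) :
    freeCorr d β h {a, diagRefl i j c b} ≤ freeCorr d β h {a, b} := by
  classical
  refine freeCorr_pair_reflect_le (diagRefl i j c) (diagRefl_involutive hij c)
    (zdGraph_adj_diagRefl i j c) (fun y : Site d => y i - y j < c) ?_ ?_ ?_
    (R := c.natAbs) (diagRefl_mem_box hij c) hβ hh ha hb hab
  · intro y hy
    simp only [diagRefl_apply hij, if_true, if_neg hij.symm, not_lt]
    omega
  · intro y hy hθy
    simp only [diagRefl_apply hij, if_true, if_neg hij.symm, not_lt] at hy hθy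
    have hyc : y i - y j = c := le_antisymm (by omega) hy
    funext l
    rw [diagRefl_apply hij]
    split_ifs with h1 h2
    · subst h1; omega
    · subst h2; omega
    · rfl
  · intro y z hyz hy hz hθz
    exfalso
    apply hθz
    simp only [not_lt] at hz
    obtain ⟨l, hl, hrest⟩ := zdGraph_adj_coord hyz
    have hzc : z i - z j = c := by
      have h1 : z i - z j ≤ y i - y j + 1 := by
        by_cases hli : l = i
        · subst hli
          have := hrest j hij.symm
          omega
        · by_cases hlj : l = j
          · subst hlj
            have := hrest i hij
            omega
          · have := hrest i (Ne.symm hli)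
            have := hrest j (Ne.symm hlj)
            omega
      omega
    funext m
    rw [diagRefl_apply hij]
    split_ifs with h1 h2
    · subst h1; omega
    · subst h2; omega
    · rfl


end ZdReflectFree

end Literature.Probability.LatticeModels

namespace Literature.Probability.LatticeModels

open Percolation Finset Filter Topology

variable {d : ℕ} {β : ℝ}

/-- `⟨σ₀ σ₀⟩^f = 1`. [folklore] -/
theorem twoPointFree_zero' (β : ℝ) : twoPointFree d β 0 = 1 := by
  have h2 : (fun L : ℕ => isingExpect (zdGraph d) (box d L) β 0 .free (spinPair 0 0)) = fun _ => (1 : ℝ) := by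
    funext L; exact isingTwoPoint_self (zdGraph d) (box d L) β 0 .free 0
  rw [twoPointFree, freeExpect, h2]
  exact (tendsto_const_nhds : Tendsto (fun _ : ℕ => (1 : ℝ)) atTop (nhds 1)).limUnder_eq

/-- **Messager–Miracle-Solé for the free two-point function, axis form** (Hegerfeldt 1977, Thm.
3.1, eq. (3.8), free boundary conditions; Duminil-Copin 2019, §4.3, (Mes-Mir)): for `β ≥ 0` and
`xᵢ ≥ 0`, `⟨σ₀ σ_{x+eᵢ}⟩^f_β ≤ ⟨σ₀ σ_x⟩^f_β`, by the reflection through `{yᵢ = xᵢ + ½}`. [cite: Hegerfeldt1977, Thm. 3.1, eq. (3.8)] [cite: MessagerMiracleSoleJSP1977, main theorem (monotonicity of ⟨σ₀σ_x⟩ under reflections)] -/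
theorem messager_miracleSole_free (hβ : 0 ≤ β) (x : Site d) (i : Fin d) (hxi : 0 ≤ x i) :
    twoPointFree d β (x + Pi.single i 1) ≤ twoPointFree d β x := by
  by_cases hx : x = 0
  · subst hx
    rw [twoPointFree_zero']
    exact twoPointFree_le_one hasBoxLimit_isingCorr_free_holds hβ _
  have hθx : axisRefl i (2 * x i + 1) x = x + Pi.single i 1 := by
    funext j
    rw [axisRefl_apply, Pi.add_apply]
    by_cases hj : j = i
    · subst hj; simp; ring
    · simp [hj]
  have hx' : x + Pi.single i 1 ≠ 0 := by
    intro h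
    have := congrFun h i
    simp at this
    omega
  rw [twoPointFree_eq_freeCorr β hx', twoPointFree_eq_freeCorr β hx, ← hθx]
  exact freeCorr_pair_axisRefl_le i (k := 2 * x i + 1) ⟨x i, rfl⟩ hβ le_rfl
    (a := 0) (by simp; omega) (by omega) (Ne.symm hx)

/-- **Messager–Miracle-Solé for the free two-point function, diagonal form** (Hegerfeldt 1977,
Thm. 3.2, eq. (3.10)): for `β ≥ 0`, `i ≠ j` and `xⱼ ≤ xᵢ`, `⟨σ₀ σ_{x+eᵢ-eⱼ}⟩^f_β ≤ ⟨σ₀ σ_x⟩^f_β`, by the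
reflection through the diagonal hyperplane `{yᵢ - yⱼ = xᵢ - xⱼ + 1}`, which maps `x` to
`x + eᵢ - eⱼ` and leaves `0` and `x` on the same side (Hegerfeldt 1977, Thm. 3.2, eq. (3.10)). [cite: MessagerMiracleSoleJSP1977, main theorem (monotonicity of ⟨σ₀σ_x⟩ under reflections)] [cite: Hegerfeldt1977, Thm. 3.2, eq. (3.10)] -/
theorem messager_miracleSole_diag_free (hβ : 0 ≤ β) (x : Site d) {i j : Fin d} (hij : i ≠ j) (hxji : x j ≤ x i) :
    twoPointFree d β (x + Pi.single i 1 - Pi.single j 1) ≤ twoPointFree d β x := by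
  by_cases hx : x = 0
  · subst hx
    rw [twoPointFree_zero']
    exact twoPointFree_le_one hasBoxLimit_isingCorr_free_holds hβ _
  set c : ℤ := x i - x j + 1 with hc
  have hθx : diagRefl i j c x = x + Pi.single i 1 - Pi.single j 1 := by
    funext l
    rw [diagRefl_apply hij, Pi.sub_apply, Pi.add_apply]
    by_cases hli : l = i
    · subst hli; simp [hij]; omega
    · by_cases hlj : l = j
      · subst hlj; simp [hli]; omega
      · simp [hli, hlj]
  have hx' : x + Pi.single i 1 - Pi.single j 1 ≠ 0 := by
    intro h
    have h1 := congrFun h i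
    have h2 := congrFun h j
    simp [hij, hij.symm] at h1 h2
    omega
  rw [twoPointFree_eq_freeCorr β hx', twoPointFree_eq_freeCorr β hx, ← hθx]
  exact freeCorr_pair_diagRefl_le hij c hβ le_rfl (a := 0) (by simp [hc]; omega) (by omega)
    (Ne.symm hx)

/-- The free two-point function `⟨σ₀σ_x⟩^f_β` is invariant under every signed coordinate permutation
of `ℤ^d` (Friedli–Velenik 2017, Exercise 3.14, free state; from `freeCorr_map_signedPerm`). [cite: FriedliVelenik2017, Exercise 3.14, p. 115] -/
theorem twoPointFree_signedPerm (β : ℝ) (π : Equiv.Perm (Fin d)) (ε : Fin d → ℤˣ) (x : Site d) :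
    twoPointFree d β (Site.signedPerm π ε x) = twoPointFree d β x := by
  by_cases hx : x = 0
  · subst hx
    rw [Site.signedPerm_zero]
  · have hx' : Site.signedPerm π ε x ≠ 0 := fun h => hx (by
      have := congrArg (Site.signedPerm π ε).symm h
      rwa [Equiv.symm_apply_apply, ← Site.signedPerm_zero π ε, Equiv.symm_apply_apply] at this)
    have hmap : ({0, x} : Finset (Site d)).map (Site.signedPerm π ε).toEmbedding = {0, Site.signedPerm π ε x} := by
      rw [Finset.map_insert, Finset.map_singleton]
      simp [Site.signedPerm_zero]
    rw [twoPointFree_eq_freeCorr β hx, twoPointFree_eq_freeCorr β hx', ← hmap, freeCorr_map_signedPerm]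

/-- Coordinate permutations leave `⟨σ₀σ_x⟩^f_β` invariant. [cite: FriedliVelenik2017, Exercise 3.14, p. 115] -/
theorem twoPointFree_perm {β : ℝ} (_hβ : 0 ≤ β) (π : Equiv.Perm (Fin d)) (x : Site d) :
    twoPointFree d β (fun i => x (π i)) = twoPointFree d β x := by
  have h : (fun i => x (π i)) = Site.signedPerm π.symm 1 x := by
    funext i
    simp
  rw [h, twoPointFree_signedPerm]

/-- Coordinate reflections leave `⟨σ₀σ_x⟩^f_β` invariant. [cite: FriedliVelenik2017, Exercise 3.14, p. 115] -/
theorem twoPointFree_reflection {β : ℝ} (_hβ : 0 ≤ β) (j : Fin d) (x : Site d) :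
    twoPointFree d β (Function.update x j (-x j)) = twoPointFree d β x := by
  have h : Function.update x j (-x j) =
      Site.signedPerm (Equiv.refl _) (Function.update 1 j (-1)) x := by
    funext i
    by_cases hij : i = j
    · subst hij
      simp
    · simp [hij]
  rw [h, twoPointFree_signedPerm]


section MMSFree

/-- Iterating (Mes-Mir) along an axis: `⟨σ₀σ_{x + m eᵢ}⟩^f_β ≤ ⟨σ₀σ_x⟩^f_β` for `xᵢ ≥ 0` and
`m ∈ ℕ` (Duminil-Copin 2019, §4.3, Exercise 37 (3)–(4)). [cite: DuminilCopin2019, Exercise 37 (3)–(4), §4.3] -/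
theorem twoPointFree_add_single_le (hβ : 0 ≤ β) (x : Site d) (i : Fin d) (hx : 0 ≤ x i) (m : ℕ) :
    twoPointFree d β (x + Pi.single i (m : ℤ)) ≤ twoPointFree d β x := by
  induction m with
  | zero => simp
  | succ m ih =>
      have h := messager_miracleSole_free hβ (x + Pi.single i (m : ℤ)) i (by simp; omega)
      have heq : x + Pi.single i (m : ℤ) + Pi.single i 1 =
          x + Pi.single i (((m + 1 : ℕ) : ℤ)) := by
        rw [add_assoc, ← Pi.single_add]
        push_cast
        rfl
      rw [heq] at h
      exact h.trans ih

/-- Zeroing a set `S` of coordinates of a site with nonnegative coordinates increases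
`⟨σ₀σ_x⟩^f_β` (iterate the axis form of (Mes-Mir) in each coordinate of `S`;
Duminil-Copin 2019, §4.3, Exercise 37 (4)). [cite: DuminilCopin2019, Exercise 37 (4), §4.3] -/
theorem twoPointFree_le_zero_coords (hβ : 0 ≤ β) (z : Site d) (hz : ∀ i, 0 ≤ z i) (S : Finset (Fin d)) :
    twoPointFree d β z ≤ twoPointFree d β (fun i => if i ∈ S then 0 else z i) := by
  induction S using Finset.induction_on with
  | empty => simp
  | insert j S hjS ih =>
      refine ih.trans ?_
      have key := twoPointFree_add_single_le hβ
        (fun i => if i ∈ insert j S then 0 else z i) j (by simp) (z j).toNat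
      have heq : ((fun i => if i ∈ insert j S then (0 : ℤ) else z i) +
          Pi.single j (((z j).toNat : ℕ) : ℤ)) = fun i => if i ∈ S then 0 else z i := by
        funext i
        rw [Int.toNat_of_nonneg (hz j)]
        by_cases hij : i = j
        · subst hij
          simp [hjS]
        · simp [hij, Finset.mem_insert]
      rw [heq] at key
      exact key

/-- For a site `z` with nonnegative coordinates and any coordinate `i₀`,
`⟨σ₀σ_z⟩^f_β ≤ ⟨σ₀σ_{z_{i₀} e_{i₀}}⟩^f_β` (zero all the other coordinates;
Duminil-Copin 2019, §4.3, Exercise 37 (4)). [cite: DuminilCopin2019, Exercise 37 (4), §4.3] -/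
theorem twoPointFree_le_single_of_nonneg (hβ : 0 ≤ β) (z : Site d) (hz : ∀ i, 0 ≤ z i) (i₀ : Fin d) :
    twoPointFree d β z ≤ twoPointFree d β (Pi.single i₀ (z i₀)) := by
  have h := twoPointFree_le_zero_coords hβ z hz (univ.erase i₀)
  have heq : (fun i => if i ∈ univ.erase i₀ then (0 : ℤ) else z i) = Pi.single i₀ (z i₀) := by
    funext i
    by_cases hi : i = i₀
    · subst hi
      simp
    · simp [hi]
  rwa [heq] at h

/-- Reflection invariance in use: `⟨σ₀σ_{|y|}⟩^f_β = ⟨σ₀σ_y⟩^f_β` where `|y| = (|y₁|,…,|y_d|)`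
(Friedli–Velenik 2017, Exercise 3.14, one coordinate reflection at a time). [cite: FriedliVelenik2017, Exercise 3.14] -/
theorem twoPointFree_abs_eq (hβ : 0 ≤ β)
    (y : Site d) : twoPointFree d β (fun i => |y i|) = twoPointFree d β y := by
  suffices h : ∀ S : Finset (Fin d),
      twoPointFree d β (fun i => if i ∈ S then |y i| else y i) = twoPointFree d β y by
    simpa using h univ
  intro S
  induction S using Finset.induction_on with
  | empty => simp
  | insert j S hjS ih =>
      rw [← ih]
      by_cases hyj : 0 ≤ y j
      · congr 1
        funext i
        by_cases hij : i = j
        · subst hij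
          simp [abs_of_nonneg hyj]
        · simp [Finset.mem_insert, hij]
      · rw [← twoPointFree_reflection hβ j (fun i => if i ∈ S then |y i| else y i)]
        congr 1
        funext i
        by_cases hij : i = j
        · subst hij
          simp [hjS, abs_of_neg (not_le.1 hyj)]
        · simp [Finset.mem_insert, hij]

/-- Permutation invariance in use: `⟨σ₀σ_{a e_{i₀}}⟩^f_β = ⟨σ₀σ_{a e_{i₁}}⟩^f_β` (transpose the
coordinates `i₀`, `i₁`; Friedli–Velenik 2017, Exercise 3.14). [cite: FriedliVelenik2017, Exercise 3.14] -/
theorem twoPointFree_single_eq_single (hβ : 0 ≤ β)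
    (i₀ i₁ : Fin d) (a : ℤ) :
    twoPointFree d β (Pi.single i₀ a) = twoPointFree d β (Pi.single i₁ a) := by
  have h := twoPointFree_perm hβ (Equiv.swap i₁ i₀) (Pi.single i₀ a)
  have heq : (fun i => (Pi.single i₀ a : Site d) (Equiv.swap i₁ i₀ i)) = Pi.single i₁ a := by
    funext i
    by_cases hi : i = i₁
    · subst hi
      simp
    · by_cases hi' : i = i₀
      · subst hi'
        rw [Equiv.swap_apply_right]
        simp [hi, Ne.symm hi]
      · rw [Equiv.swap_apply_of_ne_of_ne hi hi']
        simp [hi, hi']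
  rw [heq] at h
  exact h.symm

/-- **Left half of eq. (4.10) for the free state** (Duminil-Copin 2019, §4.3, Exercise 37 (4):
`μ_β[σ₀σ_{n e₁}] ≥ μ_β[σ₀σ_y]` for `y ∈ ∂Λ_n`, from (Mes-Mir)). Granting the tree's free-state
Messager–Miracle-Solé fact `messager_miracleSole` and the reflection/permutation invariance
of `⟨·⟩^∅` (Friedli–Velenik 2017, Exercise 3.14): for `d ≥ 1`, `β ≥ 0` and `‖y‖_∞ = n`,
`⟨σ₀σ_y⟩^f_β ≤ ⟨σ₀σ_{n e₁}⟩^f_β`. (Reflect `y` into the positive orthant, zero all coordinates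
but one where `|y_{i}| = n`, and transpose that coordinate with the first.) [cite: DuminilCopin2019, Exercise 37 (4), eq. (4.10), §4.3] [cite: MessagerMiracleSoleJSP1977, main theorem (monotonicity of ⟨σ₀σ_x⟩ under reflections)] -/
theorem twoPointFree_le_axis_of_mem_sphere'
    (hβ : 0 ≤ β) (hd : 1 ≤ d) {n : ℕ} {y : Site d} (hy : y ∈ sphere d n) :
    twoPointFree d β y ≤ twoPointFree d β (Pi.single (⟨0, hd⟩ : Fin d) (n : ℤ)) := by
  obtain ⟨i₀, hi₀⟩ := Site.exists_natAbs_eq_supNorm ⟨⟨0, hd⟩, mem_univ _⟩ y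
  rw [mem_sphere] at hy
  rw [← twoPointFree_abs_eq hβ y]
  refine (twoPointFree_le_single_of_nonneg hβ _ (fun i => abs_nonneg _) i₀).trans ?_
  have habs : |y i₀| = (n : ℤ) := by rw [Int.abs_eq_natAbs, hi₀, hy]
  change twoPointFree d β (Pi.single i₀ |y i₀|) ≤ _
  rw [habs, twoPointFree_single_eq_single hβ i₀ ⟨0, hd⟩]

/-- Collapsing the mass of a site onto its largest coordinate with the diagonal form of
(Mes-Mir): if `0 ≤ x_j ≤ x_{i₀}` for all `j ≠ i₀`, then
`⟨σ₀σ_{(∑ᵢ xᵢ) e_{i₀}}⟩^f_β ≤ ⟨σ₀σ_x⟩^f_β` (each move `x ↦ x + e_{i₀} - e_j`, allowed while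
`x_j ≤ x_{i₀}`, decreases the two-point function; Duminil-Copin 2019, §4.3, Exercise 37 (4),
"(Mes-Mir) used twice"). [cite: DuminilCopin2019, Exercise 37 (4), §4.3] -/
theorem twoPointFree_single_sum_le (hβ : 0 ≤ β) (i₀ : Fin d) :
    ∀ (M : ℕ) (x : Site d), (∀ j, j ≠ i₀ → 0 ≤ x j ∧ x j ≤ x i₀) →
      ∑ j ∈ univ.erase i₀, x j = M →
        twoPointFree d β (Pi.single i₀ (∑ i, x i)) ≤ twoPointFree d β x := by
  intro M
  induction M with
  | zero =>
      intro x hx hsum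
      have hzero : ∀ j ∈ univ.erase i₀, x j = 0 :=
        (Finset.sum_eq_zero_iff_of_nonneg fun j hj =>
          (hx j (Finset.ne_of_mem_erase hj)).1).1 (by exact_mod_cast hsum)
      have hxeq : Pi.single i₀ (x i₀) = x := by
        funext j
        by_cases hj : j = i₀
        · subst hj
          simp
        · rw [Pi.single_eq_of_ne hj]
          exact (hzero j (mem_erase.2 ⟨hj, mem_univ _⟩)).symm
      have hs : ∑ i, x i = x i₀ := by
        rw [← Finset.add_sum_erase _ _ (mem_univ i₀), Finset.sum_eq_zero hzero, add_zero]
      rw [hs, hxeq]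
  | succ M ih =>
      intro x hx hsum
      obtain ⟨j, hj, hxj⟩ : ∃ j ∈ univ.erase i₀, 0 < x j := by
        by_contra hcon
        push Not at hcon
        have hle : ∑ j ∈ univ.erase i₀, x j ≤ 0 := Finset.sum_nonpos hcon
        push_cast at hsum
        omega
      have hji : j ≠ i₀ := Finset.ne_of_mem_erase hj
      set x' : Site d := x + Pi.single i₀ 1 - Pi.single j 1 with hx'
      have hstep := messager_miracleSole_diag_free hβ x (Ne.symm hji) (hx j hji).2
      refine le_trans ?_ hstep
      have hx'i0 : x' i₀ = x i₀ + 1 := by simp [hx', Ne.symm hji]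
      have hx'j : x' j = x j - 1 := by simp [hx', hji]
      have hx'k : ∀ k, k ≠ i₀ → k ≠ j → x' k = x k := by
        intro k hk hkj
        simp [hx', hk, hkj]
      have hcond : ∀ k, k ≠ i₀ → 0 ≤ x' k ∧ x' k ≤ x' i₀ := by
        intro k hk
        by_cases hkj : k = j
        · subst hkj
          rw [hx'j, hx'i0]
          have := (hx k hk).2
          constructor <;> omega
        · rw [hx'k k hk hkj, hx'i0]
          have := hx k hk
          constructor <;> omega
      have hsum' : ∑ k ∈ univ.erase i₀, x' k = M := by
        have h1 : ∑ k ∈ univ.erase i₀, x' k + 1 = ∑ k ∈ univ.erase i₀, x k := by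
          rw [← Finset.add_sum_erase _ _ hj, ← Finset.add_sum_erase (univ.erase i₀) x hj, hx'j,
            Finset.sum_congr rfl fun k hk => hx'k k (Finset.ne_of_mem_erase (mem_of_mem_erase hk))
              (Finset.ne_of_mem_erase hk)]
          ring
        push_cast at hsum
        omega
      have htot : ∑ i, x' i = ∑ i, x i := by
        simp only [hx', Pi.sub_apply, Pi.add_apply, Finset.sum_sub_distrib,
          Finset.sum_add_distrib, Finset.sum_pi_single', mem_univ, if_true]
        ring
      rw [← htot]
      exact ih x' hcond hsum'

/-- **Right half of eq. (4.10) for the free state** (Duminil-Copin 2019, §4.3, Exercise 37 (4):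
`μ_β[σ₀σ_y] ≥ μ_β[σ₀σ_{d n e₁}]` for `y ∈ ∂Λ_n`, "(Mes-Mir) used twice"). Granting the tree's
free-state Messager–Miracle-Solé facts `messager_miracleSole`, `messager_miracleSole_diag` and
the reflection/permutation invariance of `⟨·⟩^∅` (Friedli–Velenik 2017, Exercise 3.14): for
`d ≥ 1`, `β ≥ 0` and `‖y‖_∞ = n`, `⟨σ₀σ_{d n e₁}⟩^f_β ≤ ⟨σ₀σ_y⟩^f_β`. (Reflect `y` into the
positive orthant, collapse its mass `s = ∑ᵢ |yᵢ| ≤ d n` onto a maximal coordinate `i₀` by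
diagonal moves, go out along the axis from `s` to `d n`, and transpose `i₀` with the first
coordinate.) [cite: DuminilCopin2019, Exercise 37 (4), eq. (4.10), §4.3] [cite: MessagerMiracleSoleJSP1977, main theorem (monotonicity of ⟨σ₀σ_x⟩ under reflections)] -/
theorem twoPointFree_diagAxis_le_of_mem_sphere'
    (hβ : 0 ≤ β) (hd : 1 ≤ d) {n : ℕ} {y : Site d} (hy : y ∈ sphere d n) :
    twoPointFree d β (Pi.single (⟨0, hd⟩ : Fin d) ((d : ℤ) * n)) ≤ twoPointFree d β y := by
  obtain ⟨i₀, hi₀⟩ := Site.exists_natAbs_eq_supNorm ⟨⟨0, hd⟩, mem_univ _⟩ y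
  rw [mem_sphere] at hy
  set z : Site d := fun i => |y i| with hz
  have hz0 : ∀ i, 0 ≤ z i := fun i => abs_nonneg _
  have hzle : ∀ i, z i ≤ n := fun i => by
    have h := Site.natAbs_le_supNorm y i
    rw [hy] at h
    simp only [hz, Int.abs_eq_natAbs]
    exact_mod_cast h
  have hzi0 : z i₀ = n := by
    change |y i₀| = (n : ℤ)
    rw [Int.abs_eq_natAbs, hi₀, hy]
  rw [← twoPointFree_abs_eq hβ y, twoPointFree_single_eq_single hβ ⟨0, hd⟩ i₀]
  change twoPointFree d β (Pi.single i₀ ((d : ℤ) * n)) ≤ twoPointFree d β z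
  set s : ℤ := ∑ i, z i with hs
  have hs_le : s ≤ (d : ℤ) * n := by
    calc s = ∑ i, z i := rfl
      _ ≤ ∑ _i : Fin d, (n : ℤ) := Finset.sum_le_sum fun i _ => hzle i
      _ = d * n := by simp
  have hs_ge : (n : ℤ) ≤ s := by
    rw [← hzi0]
    exact Finset.single_le_sum (fun i _ => hz0 i) (mem_univ i₀)
  have h1 : twoPointFree d β (Pi.single i₀ s) ≤ twoPointFree d β z :=
    twoPointFree_single_sum_le hβ i₀ (∑ j ∈ univ.erase i₀, z j).toNat z
      (fun j _ => ⟨hz0 j, (hzle j).trans hzi0.ge⟩)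
      (by rw [Int.toNat_of_nonneg (Finset.sum_nonneg fun j _ => hz0 j)])
  have h2 : twoPointFree d β (Pi.single i₀ ((d : ℤ) * n)) ≤ twoPointFree d β (Pi.single i₀ s) := by
    have h := twoPointFree_add_single_le hβ (Pi.single i₀ s) i₀ (by simp; omega)
      ((d : ℤ) * n - s).toNat
    rwa [← Pi.single_add, Int.toNat_of_nonneg (by omega), add_sub_cancel] at h
  exact h2.trans h1

end MMSFree

/-- **Discharge of `twoPointFree_le_axis_of_mem_sphere`** (left half of Duminil-Copin 2019, eq. (4.10),
free state): `μ^f_β[σ₀σ_y] ≤ μ^f_β[σ₀σ_{ne₁}]` for `y ∈ ∂Λ_n`, `β ≥ 0`, `d ≥ 1`. [cite: DuminilCopin2019, Exercise 37 (4), eq. (4.10), §4.3] -/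
theorem twoPointFree_le_axis_of_mem_sphere_holds : twoPointFree_le_axis_of_mem_sphere (d := d) :=
  fun hβ hd _ _ _ hy => twoPointFree_le_axis_of_mem_sphere' hβ hd hy

/-- **Discharge of `twoPointFree_diagAxis_le_of_mem_sphere`** (right half of Duminil-Copin 2019,
eq. (4.10), free state): `μ^f_β[σ₀σ_{dne₁}] ≤ μ^f_β[σ₀σ_y]` for `y ∈ ∂Λ_n`, `β ≥ 0`, `d ≥ 1`. [cite: DuminilCopin2019, Exercise 37 (4), eq. (4.10), §4.3] -/
theorem twoPointFree_diagAxis_le_of_mem_sphere_holds : twoPointFree_diagAxis_le_of_mem_sphere (d := d) :=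
  fun hβ hd _ _ _ hy => twoPointFree_diagAxis_le_of_mem_sphere' hβ hd hy

end Literature.Probability.LatticeModels
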